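import Summits.Ventures.PercRepro.SixFourResidueFourPlaneLineClauses

/-!
# (6,4) residue, plane-line case — `TWSumSmall` (the sum form at `g ∈ {11, 12}`)

The sharp sum form of Lemma TW at `g = 11, 12` (`TWSumSmall`, `SixFourResidueFourPlaneLineClauses.lean`), proved
without enumerating the `157` admissible size multisets:

* `tau g q ≤ T⁺(g, q)` for `g ∈ {11, 12}`, `4 ≤ q ≤ g − 3` — integer floors of the exact minima, certified by the
  per-`m` inequalities `C(m,2)·(base₄ + τ) ≤ C(q,2)·L₄(g,q,m)` (`Tplus_ge_of_cert`);
* a slope table `lam g n e` with `w♯(g, n, s) ≥ lam·(s − e)` for every admissible `s` (`wsharp_ge_lam`); summing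
  over the classes, `Σ_C w♯ ≥ lam·Σ_C (|C| − e) = lam·(p − e)` (`sum_wsharp_ge`);
* the final `24` numeric checks `tau(g,p) − (24/5)·n + lam·(p − e) [− (12/5)·2^{n+e}] ≥ 0`, the pair charge being
  possible only when `p ≥ 6 + e` (two classes of size `≤ p − 3` summing to `p + e`).
All margins are `≥ 36.8`.
-/

namespace PercRepro.SixFour

/-! ## Certified lower bounds for `T⁺` -/

/-- If `C(m,2)·(base₄(g,q) + τ) ≤ C(q,2)·L₄(g,q,m)` for every `2 ≤ m < q`, then `τ ≤ T⁺(g,q)` (`q ≥ 3`). -/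
theorem Tplus_ge_of_cert {g q : ℕ} (hq : 3 ≤ q) (τ : ℚ)
    (h : ∀ m, 2 ≤ m → m < q → (m.choose 2 : ℚ) * (base4 g q + τ) ≤ (q.choose 2 : ℚ) * Lterm4 g q m) :
    τ ≤ Tplus g q := by
  rw [Tplus_of_three_le hq]
  have hq2 : (0 : ℚ) < (q.choose 2 : ℚ) := by exact_mod_cast Nat.choose_pos (by omega : 2 ≤ q)
  have hinf : (base4 g q + τ) / (q.choose 2 : ℚ) ≤
      (Finset.Icc 2 (q - 1)).inf' ⟨2, by rw [Finset.mem_Icc]; omega⟩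
        (fun m => Lterm4 g q m / (m.choose 2 : ℚ)) := by
    apply Finset.le_inf'
    intro m hm
    rw [Finset.mem_Icc] at hm
    have hm2 : (0 : ℚ) < (m.choose 2 : ℚ) := by exact_mod_cast Nat.choose_pos (by omega : 2 ≤ m)
    rw [div_le_div_iff₀ hq2 hm2]
    have := h m hm.1 (by omega)
    linarith
  have := mul_le_mul_of_nonneg_left hinf hq2.le
  rw [mul_div_cancel₀ _ hq2.ne'] at this
  linarith

/-- Integer lower bounds `τ(g, q) ≤ T⁺(g, q)` for `g ∈ {11, 12}`, `4 ≤ q ≤ g − 3` (floors of the exact values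
`T⁺(11, 4..8) = 16.07, 29.46, 49.49, 80.82, 96.56` and `T⁺(12, 4..9) = 25.64, 45.92, 73.99, 113.45, 176.47, 202.81`). -/
def tau (g q : ℕ) : ℚ :=
  if g = 11 then
    (if q = 4 then 16 else if q = 5 then 29 else if q = 6 then 49 else if q = 7 then 80 else 96)
  else
    (if q = 4 then 25 else if q = 5 then 45 else if q = 6 then 73 else if q = 7 then 113
      else if q = 8 then 176 else 202)

/-- `tau g q ≤ T⁺(g, q)` for `g ∈ {11, 12}` and `4 ≤ q ≤ g − 3`. -/
theorem tau_le_Tplus {g q : ℕ} (hg : 11 ≤ g) (hg' : g ≤ 12) (hq : 4 ≤ q) (hqg : q + 3 ≤ g) :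
    tau g q ≤ Tplus g q := by
  have hq9 : q ≤ 9 := by omega
  interval_cases g <;> interval_cases q <;>
    first
    | omega
    | (refine Tplus_ge_of_cert (by norm_num) _ (fun m hm hmq => ?_)
       interval_cases m <;>
         norm_num [tau, Lterm4, base4, yPrice4, yP4, Fg, bonus, eps, delta, S3, Nat.choose])

/-! ## The slope table -/

/-- Slopes `lam g n e ≤ min_s (tau g (n+s) − (12/5)·2^s − (24/5)·n)/(s − e)` over the admissible `1 + e ≤ s ≤ p − 3`
(`p = g − n`), rounded down to tenths; the two cells without admissible `s` (`(11,7,1)`, `(12,8,1)`) are idle. -/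
def lam (g n e : ℕ) : ℚ :=
  if g = 11 then
    (if n = 3 then (if e = 0 then -16 / 5 else 6 / 5)
      else if n = 4 then (if e = 0 then 5 else 64 / 5)
      else if n = 5 then (if e = 0 then 88 / 5 else 132 / 5)
      else if n = 6 then (if e = 0 then 144 / 5 else 288 / 5)
      else 288 / 5)
  else
    (if n = 3 then (if e = 0 then 28 / 5 else 34 / 5)
      else if n = 4 then (if e = 0 then 21 else 53 / 2)
      else if n = 5 then (if e = 0 then 349 / 10 else 93 / 2)
      else if n = 6 then (if e = 0 then 513 / 10 else 77)
      else if n = 7 then (if e = 0 then 397 / 5 else 794 / 5)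
      else 794 / 5)

/-- The termwise slope bound: `lam g n e · (s − e) ≤ w♯(g, n, s)` for every admissible `s`. -/
theorem wsharp_ge_lam {g n e s : ℕ} (hg : 11 ≤ g) (hg' : g ≤ 12) (hn : 3 ≤ n) (he : e ≤ 1)
    (hs1 : e + 1 ≤ s) (hs2 : s + 3 ≤ g - n) : lam g n e * ((s : ℚ) - e) ≤ wsharp g n s := by
  have hT := tau_le_Tplus hg hg' (q := n + s) (by omega) (by omega)
  have hn8 : n ≤ 8 := by omega
  have hs6 : s ≤ 6 := by omega
  have key : lam g n e * ((s : ℚ) - e) ≤ tau g (n + s) - 12 / 5 * (2 : ℚ) ^ s - 24 / 5 * (n : ℚ) := by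
    interval_cases g <;> interval_cases n <;> interval_cases e <;> interval_cases s <;>
      first | omega | norm_num [lam, tau]
  unfold wsharp
  linarith

/-- Summing the slope bound over the classes: `lam·(p − e) ≤ Σ_C w♯(g, n, |C|)`. -/
theorem sum_wsharp_ge {g n e : ℕ} (hg : 11 ≤ g) (hg' : g ≤ 12) (hn : 3 ≤ n) (he : e ≤ 1)
    {sizes : Multiset ℕ} (hs : ∀ s ∈ sizes, e + 1 ≤ s ∧ s + 3 ≤ g - n)
    (hsum : sizes.sum = (g - n - e) + e * Multiset.card sizes) :
    lam g n e * ((g - n - e : ℕ) : ℚ) ≤ (sizes.map fun s => wsharp g n s).sum := by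
  have h1 : (sizes.map fun s : ℕ => lam g n e * ((s : ℚ) - e)).sum ≤ (sizes.map fun s => wsharp g n s).sum :=
    Multiset.sum_map_le_sum_map _ _ (fun s hs' => wsharp_ge_lam hg hg' hn he (hs s hs').1 (hs s hs').2)
  have h2 : ∀ t : Multiset ℕ, (t.map fun s : ℕ => lam g n e * ((s : ℚ) - e)).sum =
      lam g n e * ((t.sum : ℚ) - e * Multiset.card t) := by
    intro t
    induction t using Multiset.induction_on with
    | empty => simp
    | cons a t ih =>
      simp only [Multiset.map_cons, Multiset.sum_cons, ih, Multiset.card_cons]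
      push_cast
      ring
  have h3 : (sizes.map fun s : ℕ => lam g n e * ((s : ℚ) - e)).sum = lam g n e * ((g - n - e : ℕ) : ℚ) := by
    rw [h2 sizes, hsum]
    push_cast
    ring
  linarith

/-! ## `TWSumSmall` -/

/-- **`TWSumSmall` holds**: the sharp sum form of Lemma TW at `g ∈ {11, 12}`. -/
theorem twSumSmall_holds : TWSumSmall := by
  intro g n e hg hg' hn he hng sizes hs hsum
  have hp4 : 4 ≤ g - n := by omega
  -- a class exists, so `p ≥ e + 4`
  have hne : n + e + 4 ≤ g := by
    rcases Multiset.empty_or_exists_mem sizes with h0 | ⟨s, hs0⟩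
    · subst h0
      simp at hsum
      omega
    · have := hs s hs0
      omega
  have hT := tau_le_Tplus hg hg' hp4 (by omega)
  have hS := sum_wsharp_ge hg hg' hn he hs hsum
  have hn8 : n ≤ 8 := by omega
  unfold pairCharge
  by_cases hpair : Multiset.card sizes = 2 ∧ sizes.sum = g - n + e
  · -- a covering pair: two classes of size `≤ p − 3` sum to `p + e`, so `p ≥ 6 + e`
    rw [if_pos hpair]
    have hle : sizes.sum ≤ Multiset.card sizes • (g - n - 3) :=
      Multiset.sum_le_card_nsmul sizes (g - n - 3) (fun x hx => by have := (hs x hx).2; omega)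
    rw [hpair.1, hpair.2] at hle
    have h6 : 6 + e ≤ g - n := by
      simp only [smul_eq_mul] at hle
      omega
    have hnum : 0 ≤ tau g (g - n) - 24 / 5 * (n : ℚ) + lam g n e * ((g - n - e : ℕ) : ℚ) -
        12 / 5 * (2 : ℚ) ^ (n + e) := by
      interval_cases g <;> interval_cases n <;> interval_cases e <;> first | omega | norm_num [tau, lam]
    linarith
  · rw [if_neg hpair]
    have hnum : 0 ≤ tau g (g - n) - 24 / 5 * (n : ℚ) + lam g n e * ((g - n - e : ℕ) : ℚ) := by
      interval_cases g <;> interval_cases n <;> interval_cases e <;> first | omega | norm_num [tau, lam]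
    linarith

end PercRepro.SixFour
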